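import Summits.QuantumFields.BalabanUV.Beta.GAN24.ContactCellRefine

/-!
# `BalabanUV.Beta.GAN24.ContactCellRefineFaces` — binder row G-an2-4 / (CONV-C), the row owner's CONTACT-TERM ROUTE, **CT-4c** (`gen19/CT4-DESIGN-v0.md` §3
# «`ContactCellRefine` … Owner or leaf-02»), PART 2: **ONE STEP ACROSS A CELL FACE, AND THE CELL-CONSTANT FACE SUM** — the lattice facts behind the tip-weight
# realignment of PART 3 (`ContactCellRefineTip`): where PART 1's pointwise comparison (`ContactCellRefine.abs_refine3_le`) does NOT apply letter by letter.

NOT IN PRINT; OUR BOOKKEEPING (G-an2-4 formalisation swarm, leaf prover `b2b-balaban-gan24-formalise-leaf-02`, gen 50; «MINE (CT-4c)» journal `CLAIMS.log`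
l.35439; re-cut after leaf-01 g61's W-leaf01-g61-3 l.35569 and gan24-p2 g34's «MINE (CT-4c-P)» l.35579 — the GRADIENT-SLOT (pairing) half of CT-4c is p2's
`ContactTentFaceAvg` ∕ `ContactRefineP` by exact far-face transport; journal W-leaf02-g50-2 l.≈35600).  HONEST FRAMING (cell contract, verbatim): «discharging
`BetaPertH` makes Bałaban's UV stability UNCONDITIONAL — a real constructive-QFT result; it is NOT the continuum limit and NOT the Clay problem.»  HONEST
DEPENDENCY (verbatim): «continuum YM on T⁴ ⇐ BetaPertH ∧ nine spine estimates (0/9 proved); BetaPertH ⇐ (D1) ∧ (D4) ∧ CAP+tail; G-an2-4 gates asym,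
D1 and NE2/3/4.»

WHY.  The TIP weight `ψ(c + e_κ)` of my lineage's `cell_eq` (`ContactOneGaugeCell`, p272832) read through the cell map `quo L` is `ψ(quo L x + e_κ)`, which differs
from the aligned reading `ψ(quo L (x + e_κ))` OFF the cell faces by the coarse jump `ψ(c + e_κ) − ψ c` (§1 `jump_comp_quo_eq_ite`); summed against a cell-constant
factor, the aligned fine′ gradient is a FACE SUM worth exactly `L^d·Σ'_c` (§2 `tsum_comp_quo_mul_jump_eq`), against the whole-cell reading `L^{d+1}·Σ'_c` of PART 1.

WHAT (generic `d`; 0 `def`, 0 cited fact, 0 `def … : Prop`, 0 sorry; [folklore] bookkeeping BY NAME over PART 1, the owner's `StaircaseFaces`, leaf-04's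
`TaylorBlockSum`).
* §1 `quo_add_unitVec_of_dvd` (`L ∣ x_κ+1 ⇒ quo L (x+e_κ) = quo L x + e_κ`), `quo_add_unitVec_of_not_dvd` (else `= quo L x` — the owner's (F1)
  `StaircaseFaces.blk_add_unitVec_of_not_dvd` in the cells' `quo` ∕ `B6BondElimination.unitVec` spelling), **`jump_comp_quo_eq_ite`**:
  `g(quo L (x+e_κ)) − g(quo L x) = [L ∣ x_κ+1]·(g(quo L x + e_κ) − g(quo L x))` for EVERY `g` (gan24-p2 g34's `ContactTentFaceAvg.blk_cell_add_unitVec` is the same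
  fact in box coordinates).
* §2 `summable_mul_jump_of_env`, `abs_staircase_le` (a staircase is bounded by the sum of its amplitudes); **`tsum_comp_quo_mul_jump_eq`** —
  `Σ'_x F κ (quo L x)·(g(quo L (x+e_κ)) − g(quo L x)) = L^d·Σ'_c F κ c·(g(c+e_κ) − g c)` (the owner's (F2) `StaircaseFaces.tsum_ite_dvd_eq` at `P = L` + PART 1's
  reading); `tsum_mul_jump_sub_eq` — the difference identity `Σ'_x F′·dg̃ − L^d·Σ'_c F·dg = Σ'_x (F′ − F̃)·dg̃` (`g̃ := g ∘ quo L`, one differenced ingredient at the face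
  sites against the undifferenced coarse jump); `abs_mul_sub_mul_le_env` — the pointwise letter of a product `|W′M′ − W̃M̃| ≤ (εw·E₃ + Ew·ε₃)·E_{z₀}E_{z₃}`.
Discharges NOTHING of hSdev by itself; 0 wall binders; NEVER «G-an2-4 closed» as (CONV-C); NOT D1, NOT BetaPertH, NOT continuum, NOT Clay.
-/

noncomputable section

open Finset
open scoped BigOperators
open Literature.MathematicalPhysics.QuantumFieldTheory
open Literature.MathematicalPhysics.QuantumFieldTheory.LatticeForm (quo)
open Literature.MathematicalPhysics.QuantumFieldTheory.Balaban1983to89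
open Literature.MathematicalPhysics.QuantumFieldTheory.Balaban1983to89.Beta
open B4ContourShift (supNorm supNorm_nonneg)
open ExpKernelCalculus (Zl Zl_nonneg)
open AffineAveraging (Form0 Form1 Site box toSite)
open AveragingContours (blk)
open B6BondElimination (unitVec unitVec_apply)
open Summit.QuantumFields.BalabanUV.Beta.GAN24.EnvelopeBlockSum (env_le_one summable_env)
open Summit.QuantumFields.BalabanUV.Beta.GAN24.StaircaseFaces (blk_add_unitVec_of_not_dvd tsum_ite_dvd_eq quo_quo quo_zsmul_add_toSite_of_dvd)
open Summit.QuantumFields.BalabanUV.Beta.GAN24.ContactOneGaugeCellBound (tsum_env3_le abs_tsum_weight_mul_mul_le abs_tip_weight_le abs_mid_weight_le)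
open Summit.QuantumFields.BalabanUV.Beta.GAN24.ContactCellRefine (quo_quo' tsum_comp_quo' summable_comp_quo')


namespace Summit.QuantumFields.BalabanUV.Beta.GAN24.ContactCellRefineFaces

variable {d : ℕ}

/-! ## §1 One step across a cell face -/

section Face

variable {L : ℕ}

/-- [folklore] ON a cell face one step forward moves the label forward: `L ∣ x_κ + 1 ⇒ quo L (x + e_κ) = quo L x + e_κ`. -/
theorem quo_add_unitVec_of_dvd (hL : 1 ≤ L) {x : Site (d + 1)} {κ : Fin (d + 1)} (h : (L : ℤ) ∣ x κ + 1) :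
    quo L (x + unitVec κ) = quo L x + unitVec κ := by
  have hL' : (0 : ℤ) < L := by exact_mod_cast hL
  funext j
  simp only [quo, Pi.add_apply, unitVec_apply]
  by_cases hj : j = κ
  · subst hj
    rw [if_pos rfl]
    have hm := Int.mul_ediv_cancel' h
    have hq : x j / (L : ℤ) = (x j + 1) / L - 1 ∧ x j % (L : ℤ) = L - 1 :=
      (Int.ediv_emod_unique hL').2 ⟨by linear_combination hm, by omega, by omega⟩
    omega
  · rw [if_neg hj, add_zero, add_zero]

/-- [folklore] OFF the cell faces one step keeps the label: `L ∤ x_κ + 1 ⇒ quo L (x + e_κ) = quo L x` (the owner's (F1) `StaircaseFaces.blk_add_unitVec_of_not_dvd`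
in the cells' spelling). -/
theorem quo_add_unitVec_of_not_dvd (hL : 1 ≤ L) {x : Site (d + 1)} {κ : Fin (d + 1)} (h : ¬ (L : ℤ) ∣ x κ + 1) :
    quo L (x + unitVec κ) = quo L x := by
  have haff : AffineAveraging.unitVec κ = unitVec κ := funext fun i => by rw [AffineAveraging.unitVec_apply, unitVec_apply]
  have hb : blk L (x + AffineAveraging.unitVec κ) = blk L x := blk_add_unitVec_of_not_dvd hL h
  rw [haff] at hb
  exact hb

/-- [folklore] **THE FINE′ GRADIENT OF A CELL-CONSTANT FUNCTION IS THE COARSE JUMP ON THE FACES** (every `g`):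
`g(quo L (x + e_κ)) − g(quo L x) = [L ∣ x_κ + 1]·(g(quo L x + e_κ) − g(quo L x))`. -/
theorem jump_comp_quo_eq_ite (hL : 1 ≤ L) (g : Form0 (d + 1) ℝ) (x : Site (d + 1)) (κ : Fin (d + 1)) :
    g (quo L (x + unitVec κ)) - g (quo L x) = if (L : ℤ) ∣ x κ + 1 then g (quo L x + unitVec κ) - g (quo L x) else 0 := by
  by_cases h : (L : ℤ) ∣ x κ + 1
  · rw [if_pos h, quo_add_unitVec_of_dvd hL h]
  · rw [if_neg h, quo_add_unitVec_of_not_dvd hL h, sub_self]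

end Face

/-! ## §2 Cell sums across the faces: the face sum, the difference identity, the product letter -/

section CellSums

variable {L : ℕ}

/-- [folklore] A factor under a product envelope against the difference of a bounded function is summable. -/
theorem summable_mul_jump_of_env {N : ℕ} (hN : 1 ≤ N) {κ₀ : ℝ} (hκ : 0 < κ₀) {Φ : Form1 (d + 1) ℝ} {h : Form0 (d + 1) ℝ} {A Bh : ℝ}
    (hA : 0 ≤ A) {z₁ z₃ : Site (d + 1)}
    (hΦ : ∀ κ u, |Φ κ u| ≤ A * (Real.exp (-(κ₀ * supNorm (quo N u - z₁))) * Real.exp (-(κ₀ * supNorm (quo N u - z₃)))))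
    (hh : ∀ u, |h u| ≤ Bh) (κ : Fin (d + 1)) (e : Site (d + 1)) :
    Summable fun u : Site (d + 1) => Φ κ u * (h (u + e) - h u) := by
  have hBh : 0 ≤ Bh := (abs_nonneg _).trans (hh 0)
  refine Summable.of_norm_bounded ((summable_env hN hκ z₁).mul_left (A * (2 * Bh))) (fun u => ?_)
  rw [Real.norm_eq_abs, abs_mul]
  have h1 := hΦ κ u
  have h2 : |h (u + e) - h u| ≤ 2 * Bh := by
    have := abs_sub (h (u + e)) (h u); have := hh (u + e); have := hh u; linarith
  have h3 : Real.exp (-(κ₀ * supNorm (quo N u - z₁))) * Real.exp (-(κ₀ * supNorm (quo N u - z₃)))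
      ≤ Real.exp (-(κ₀ * supNorm (quo N u - z₁))) := by
    have := env_le_one (L := N) hκ.le z₃ u
    have h0 : 0 ≤ Real.exp (-(κ₀ * supNorm (quo N u - z₁))) := by positivity
    nlinarith
  calc |Φ κ u| * |h (u + e) - h u|
      ≤ (A * (Real.exp (-(κ₀ * supNorm (quo N u - z₁))) * Real.exp (-(κ₀ * supNorm (quo N u - z₃))))) * (2 * Bh) :=
        mul_le_mul h1 h2 (abs_nonneg _) (by positivity)
    _ ≤ (A * Real.exp (-(κ₀ * supNorm (quo N u - z₁)))) * (2 * Bh) := by gcongr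
    _ = A * (2 * Bh) * Real.exp (-(κ₀ * supNorm (quo N u - z₁))) := by ring

/-- [folklore] A staircase with per-scale block envelopes is bounded by the sum of its amplitudes. -/
theorem abs_staircase_le {N k : ℕ} {κ₀ : ℝ} (hκ : 0 ≤ κ₀) {P : ℕ → ℕ} {G : ℕ → Form0 (d + 1) ℝ} {a : ℕ → ℝ} {z₀ : Site (d + 1)}
    (hG : ∀ s, s ≤ k → ∀ c, |G s (blk (P s) c)| ≤ a s * Real.exp (-(κ₀ * supNorm (quo N c - z₀))))
    {g : Form0 (d + 1) ℝ} (hg : ∀ c, g c = ∑ s ∈ Finset.range (k + 1), G s (blk (P s) c)) (ha : ∀ s, 0 ≤ a s) (c : Site (d + 1)) :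
    |g c| ≤ ∑ s ∈ Finset.range (k + 1), a s := by
  rw [hg c]
  refine (Finset.abs_sum_le_sum_abs _ _).trans (Finset.sum_le_sum fun s hs => ?_)
  have hsk : s ≤ k := Nat.lt_succ_iff.1 (Finset.mem_range.1 hs)
  have h1 := hG s hsk c
  have h2 := env_le_one (L := N) hκ z₀ c
  have := ha s
  nlinarith

/-- [folklore] **THE SHORTER TOWER'S GRADIENT SLOT READ ON THE FINE′ LATTICE IS A FACE SUM**: for a cell-constant factor `F ∘ quo L` against the fine′ gradient
of a cell-constant `g ∘ quo L` (direction `κ`),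
`Σ'_x F κ (quo L x)·(g(quo L (x + e_κ)) − g(quo L x)) = L^d·Σ'_c F κ c·(g(c + e_κ) − g c)`
— the summand is the coarse jump on the `κ`-faces of the cells (§1), which are exactly `L⁻¹` of the `L^{d+1}` points of each cell (the owner's (F2)
`StaircaseFaces.tsum_ite_dvd_eq` + leaf-04's `tsum_comp_quo`).  Against the whole-cell reading `L^{d+1}·Σ'_c` of PART 1 this is the factor `L⁻¹` that the taller
tower's finer unit gradient (`N′ = L·N`) restores EXACTLY. -/
theorem tsum_comp_quo_mul_jump_eq (hL : 1 ≤ L) (F : Form1 (d + 1) ℝ) (g : Form0 (d + 1) ℝ) (κ : Fin (d + 1))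
    (hs : Summable fun c : Site (d + 1) => F κ c * (g (c + unitVec κ) - g c)) :
    (Summable fun x : Site (d + 1) => F κ (quo L x) * (g (quo L (x + unitVec κ)) - g (quo L x))) ∧
    ∑' x : Site (d + 1), F κ (quo L x) * (g (quo L (x + unitVec κ)) - g (quo L x))
      = (L : ℝ) ^ d * ∑' c : Site (d + 1), F κ c * (g (c + unitVec κ) - g c) := by
  haveI : NeZero L := ⟨by omega⟩
  set H : Site (d + 1) → ℝ := fun c => F κ c * (g (c + unitVec κ) - g c) with hH
  have hHq : Summable fun x : Site (d + 1) => H (quo L x) := summable_comp_quo' hL hs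
  have hpt : ∀ x : Site (d + 1), F κ (quo L x) * (g (quo L (x + unitVec κ)) - g (quo L x))
      = if (L : ℤ) ∣ x κ + 1 then H (quo L x) else 0 := by
    intro x
    rw [jump_comp_quo_eq_ite hL g x κ]
    split_ifs
    · rfl
    · rw [mul_zero]
  have hconst : ∀ (w : Site (d + 1)) (r : Fin (d + 1) → ℕ), r ∈ box (d + 1) L →
      H (quo L ((L : ℤ) • w + toSite r)) = H (quo L ((L : ℤ) • w)) := by
    intro w r hr
    rw [quo_zsmul_add_toSite_of_dvd (N := L) hL (dvd_refl L) w hr]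
  have hmaj : Summable fun x : Site (d + 1) => if (L : ℤ) ∣ x κ + 1 then H (quo L x) else 0 := by
    refine Summable.of_norm_bounded hHq.norm (fun x => ?_)
    split_ifs
    · exact le_rfl
    · rw [norm_zero]; exact norm_nonneg _
  refine ⟨hmaj.congr fun x => (hpt x).symm, ?_⟩
  rw [tsum_congr hpt, tsum_ite_dvd_eq hL hHq hconst κ, tsum_comp_quo' hL hs]
  have hL0 : (L : ℝ) ≠ 0 := by exact_mod_cast (show L ≠ 0 by omega)
  have e : ((L : ℝ))⁻¹ * ((L : ℝ) ^ (d + 1) * ∑' c : Site (d + 1), H c) = (((L : ℝ))⁻¹ * L) * ((L : ℝ) ^ d * ∑' c : Site (d + 1), H c) := by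
    ring
  rw [e, inv_mul_cancel₀ hL0, one_mul]

/-- [folklore] **THE DIFFERENCE IDENTITY OF THE GRADIENT SLOT**: with `g̃ := g ∘ quo L`, a fine′ factor `F′` and the tower-`k` factor `F`,
`Σ'_x F′ κ x·(g̃(x + e_κ) − g̃ x) − L^d·Σ'_c F κ c·(g(c + e_κ) − g c) = Σ'_x (F′ κ x − F κ (quo L x))·(g̃(x + e_κ) − g̃ x)`
— ONE differenced ingredient (the factor, at the face sites) against the UNdifferenced coarse jump. -/
theorem tsum_mul_jump_sub_eq (hL : 1 ≤ L) (F' F : Form1 (d + 1) ℝ) (g : Form0 (d + 1) ℝ) (κ : Fin (d + 1))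
    (hs' : Summable fun x : Site (d + 1) => F' κ x * (g (quo L (x + unitVec κ)) - g (quo L x)))
    (hs : Summable fun c : Site (d + 1) => F κ c * (g (c + unitVec κ) - g c)) :
    (Summable fun x : Site (d + 1) => (F' κ x - F κ (quo L x)) * (g (quo L (x + unitVec κ)) - g (quo L x))) ∧
    ∑' x : Site (d + 1), F' κ x * (g (quo L (x + unitVec κ)) - g (quo L x))
        - (L : ℝ) ^ d * ∑' c : Site (d + 1), F κ c * (g (c + unitVec κ) - g c)
      = ∑' x : Site (d + 1), (F' κ x - F κ (quo L x)) * (g (quo L (x + unitVec κ)) - g (quo L x)) := by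
  obtain ⟨hsq, heq⟩ := tsum_comp_quo_mul_jump_eq hL F g κ hs
  refine ⟨(hs'.sub hsq).congr fun x => by ring, ?_⟩
  rw [← heq, ← hs'.tsum_sub hsq]
  exact tsum_congr fun x => by ring

/-- [folklore] The product of two factors, differenced: `|W′·M′ − W̃·M̃| ≤ (εw·E₃ + Ew·ε₃)·E_{z₀}·E_{z₃}` from `|W′ − W̃| ≤ εw·E_{z₀}`, `|M′| ≤ E₃·E_{z₃}`,
`|W̃| ≤ Ew·E_{z₀}`, `|M′ − M̃| ≤ ε₃·E_{z₃}` — the pointwise letter `εF` of the gradient slot's factor `F = w·M` (weight × tent). -/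
theorem abs_mul_sub_mul_le_env {N : ℕ} {κ₀ : ℝ} {W' M' Wq Mq : Form1 (d + 1) ℝ} {z₀ z₃ : Site (d + 1)} {Ew E₃ εw ε₃ : ℝ}
    (hEw : 0 ≤ Ew)
    (hdW : ∀ κ x, |W' κ x - Wq κ x| ≤ εw * Real.exp (-(κ₀ * supNorm (quo N x - z₀))))
    (hWq : ∀ κ x, |Wq κ x| ≤ Ew * Real.exp (-(κ₀ * supNorm (quo N x - z₀))))
    (hM' : ∀ κ x, |M' κ x| ≤ E₃ * Real.exp (-(κ₀ * supNorm (quo N x - z₃))))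
    (hdM : ∀ κ x, |M' κ x - Mq κ x| ≤ ε₃ * Real.exp (-(κ₀ * supNorm (quo N x - z₃)))) (κ : Fin (d + 1)) (x : Site (d + 1)) :
    |W' κ x * M' κ x - Wq κ x * Mq κ x| ≤
      (εw * E₃ + Ew * ε₃) * (Real.exp (-(κ₀ * supNorm (quo N x - z₀))) * Real.exp (-(κ₀ * supNorm (quo N x - z₃)))) := by
  have e : W' κ x * M' κ x - Wq κ x * Mq κ x = (W' κ x - Wq κ x) * M' κ x + Wq κ x * (M' κ x - Mq κ x) := by ring
  rw [e]
  have h1 := hdW κ x; have h2 := hM' κ x; have h3 := hWq κ x; have h4 := hdM κ x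
  have hE₃ : 0 ≤ E₃ * Real.exp (-(κ₀ * supNorm (quo N x - z₃))) := (abs_nonneg _).trans h2
  have hεw : 0 ≤ εw * Real.exp (-(κ₀ * supNorm (quo N x - z₀))) := (abs_nonneg _).trans h1
  calc |(W' κ x - Wq κ x) * M' κ x + Wq κ x * (M' κ x - Mq κ x)|
      ≤ |W' κ x - Wq κ x| * |M' κ x| + |Wq κ x| * |M' κ x - Mq κ x| := by
        have := abs_add_le ((W' κ x - Wq κ x) * M' κ x) (Wq κ x * (M' κ x - Mq κ x))
        rwa [abs_mul, abs_mul] at this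
    _ ≤ (εw * Real.exp (-(κ₀ * supNorm (quo N x - z₀)))) * (E₃ * Real.exp (-(κ₀ * supNorm (quo N x - z₃)))) +
          (Ew * Real.exp (-(κ₀ * supNorm (quo N x - z₀)))) * (ε₃ * Real.exp (-(κ₀ * supNorm (quo N x - z₃)))) :=
        add_le_add (mul_le_mul h1 h2 (abs_nonneg _) hεw) (mul_le_mul h3 h4 (abs_nonneg _) (by positivity))
    _ = _ := by ring

end CellSums

end Summit.QuantumFields.BalabanUV.Beta.GAN24.ContactCellRefineFaces

end
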